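import Summits.BirchSwinnertonDyer.BirchSwinnertonDyer.Theorems.SchneiderFreeAdditiveX3ArtinLinkGenus
import Summits.BirchSwinnertonDyer.BirchSwinnertonDyer.Theorems.SchneiderFreeAdditiveX3BranchIMCRebaseArtin
import Summits.BirchSwinnertonDyer.Rank1Residual.Additive.UnramifiedBaseChange
import HarnessLib

/-!
# Route `SchneiderFreeAdditiveX3` (K1 door), cruxes `PotMultBranchIMC` / `GordTwoBranchIMC`
# (items stmt-BirchSwinnertonDyer-19176 / 19177): the Artin link ON THE DOOR — `hArtin` of the
# (M) road and the Gross-2004 input of the (G) road, DISCHARGED (want W2, FILE 4)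

Cell `bsd-schneider-ideate`, seat `bsd-schneider-door-c4` (prover, generation 8). HONEST FRAMING:
theorems only; both cruxes stay OPEN (they still rest on the branch divisibility h3 — Keller–Yin
2410.23241 Thm 3.5.1, PREPRINT, on (G); research on (M) — and on the conductor-`p` `p`-adic value
formula, printed on (G) modulo typing, NOT in print on (M)); BSD is not advanced.

`artinLink_genus_door` is `artinLink_genus` (`…ArtinLinkGenus.lean`) read in the binders of the
door's two value roads — door-c3's rebased road on the (G-ord, `e = 2`) cell
(`additiveIMCLowerBDPOnTreeLeAt_of_valueAt_twisted_of_genusDatum′`, where the link came from the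
CITE-ONLY `Gross2004.rankinLSeries_eq_mul_quadraticTwist` through `artinLink_of_gross2004`) and
door-c2 g8's (M) twin (`potMult_additiveIMCLowerBDPOnTreeLeAt_of_valueAt_twisted_of_thm15_of_genusDatum`,
where it is the HYPOTHESIS `hArtin`): the door's curve presented as `W = C₂ • ((D • V) ⊗ χ_{p*})`
through a globally minimal partner `V` (good at `p` on (G), multiplicative at `p` on (M)), `W`
additive at `p` (`Addv`, from `ClassX3`), an imaginary quadratic Heegner field `K` for `N_W` with
the frame's degree-one prime `𝔭 ∋ p`, and the genus datum `θ ∈ K[p]`, `θ² = p*`, `σθ = χ(σ)θ`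
(which makes `χ_gal` rational for `p*`, door-c3's `isRationalCharacterFor_of_genusDatum`). Its
hypotheses are discharged as follows: `p` is unramified in `K` by the degree-one `𝔭`; at a prime
`ℓ ∣ N_W` the field `K` is split (Heegner), hence unramified, and at `ℓ ∤ N_W` the curve `W` is good
(tree `dvd_conductorNorm_iff`), so "unramified or semistable" holds everywhere; the entire
continuations come from the modularity fact `hasEntireLFunction_rat` (a conjunct of `PrintedFacts`).
The only remaining named inputs of the link are therefore modularity facts already in
`PrintedFacts`; NO `(c, N) = 1`, NO `HeegnerConditionRC`, NO Gross-2004 fact.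

References: Gross, MSRI Publ. 49 (2004) §2–§3; Ireland–Rosen Prop. 20.5.4 (b); Silverman *AEC*
App. C §16.
-/

noncomputable section

open scoped NumberField NumberTheorySymbols Classical
open Field IsDedekindDomain NumberField
open Literature.NumberTheory.GaloisRepresentations
open Literature.NumberTheory.EllipticCurves.ModularForms

-- D-0017 layout: summit = sub-problem, so `Summit.BirchSwinnertonDyer.BirchSwinnertonDyer.…` is the
-- mandated namespace (same option as the route's sockets files).
set_option linter.dupNamespace false
set_option autoImplicit false

namespace Summit.BirchSwinnertonDyer.BirchSwinnertonDyer.Theorems.SchneiderFree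

open Literature.NumberTheory.EllipticCurves Literature.NumberTheory.EllipticCurves.CaiShuTian2014
  Literature.NumberTheory.EllipticCurves.Rank1Residual Rat.HeightOneSpectrum

/-- **"Unramified or semistable" on the door.** For `W/ℚ` elliptic and a quadratic Galois field
`K` in which every prime of `N_W` SPLITS (Heegner hypothesis): at every rational place either `K` is
unramified (`e = 1`: a split prime has two degree-one primes above it) or `W` is semistable (indeed
good: `ℓ ∤ N_W`, tree `dvd_conductorNorm_iff`). [cite: GrossLMS1991, §1 (Heegner hypothesis)]
[cite: NeukirchANT1999, Ch. I §8 (8.2)] -/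
theorem ramificationIdxIn_eq_one_or_isSemistableAt_of_heegner (W : WeierstrassCurve ℚ) [W.IsElliptic]
    (K : Type) [Field K] [NumberField K] [IsGalois ℚ K] (h2 : Module.finrank ℚ K = 2)
    (hHe : SatisfiesHeegnerHypothesis (W.conductorNorm ℤ) K) (v : HeightOneSpectrum (𝓞 ℚ)) :
    v.asIdeal.ramificationIdxIn (𝓞 K) = 1 ∨ W.IsSemistableAt v := by
  set ℓ : ℕ := (primesEquiv v : ℕ) with hℓ
  have hℓp : ℓ.Prime := (primesEquiv v).2
  by_cases hdvd : ℓ ∣ W.conductorNorm ℤ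
  · -- `ℓ ∣ N_W`: `ℓ` splits in `K`, hence is unramified
    left
    haveI : Fact ℓ.Prime := ⟨hℓp⟩
    have hs : Summit.BirchSwinnertonDyer.Rank1Residual.X11b.SplitsIn K ℓ := hHe ℓ hℓp hdvd
    obtain ⟨𝔭, h𝔭, he, -⟩ :=
      Summit.BirchSwinnertonDyer.Rank1Residual.X11b.exists_degreeOnePrime_of_splitsIn K ℓ h2 hs
    have hmem : ((ℓ : ℕ) : 𝓞 ℚ) ∈ (𝔭.under (𝓞 ℚ)).asIdeal := by
      rw [HeightOneSpectrum.under_asIdeal, Ideal.under_def, Ideal.mem_comap, map_natCast]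
      exact h𝔭
    have hv : 𝔭.under (𝓞 ℚ) = v := by
      rw [(natCast_mem_asIdeal_iff_eq_primesEquiv_symm _ hℓp).mp hmem]
      have hprimes : (⟨ℓ, hℓp⟩ : Nat.Primes) = primesEquiv v := Subtype.ext rfl
      rw [hprimes, Equiv.symm_apply_apply]
    haveI : 𝔭.asIdeal.LiesOver v.asIdeal := ⟨by rw [← hv, HeightOneSpectrum.under_asIdeal]⟩
    haveI : Module.Finite (𝓞 ℚ) (𝓞 K) := IsIntegralClosure.finite (𝓞 ℚ) ℚ K (𝓞 K)
    haveI : IsGaloisGroup (K ≃ₐ[ℚ] K) (𝓞 ℚ) (𝓞 K) :=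
      IsGaloisGroup.of_isFractionRing (K ≃ₐ[ℚ] K) (𝓞 ℚ) (𝓞 K) ℚ K
    rw [Ideal.ramificationIdxIn_eq_ramificationIdx v.asIdeal 𝔭.asIdeal (K ≃ₐ[ℚ] K)]
    exact he
  · -- `ℓ ∤ N_W`: good reduction
    right
    exact Or.inl (not_not.mp ((W.dvd_conductorNorm_iff v).not.mp hdvd))

/-- **THE ARTIN LINK ON THE DOOR (want W2), fact-free up to modularity.** For `p` odd, a globally
minimal elliptic `V/ℚ`, changes of variables `D`, `C₂` with `W = C₂ • ((D • V) ⊗ χ_{p*})` globally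
minimal elliptic and ADDITIVE at `p` (`Addv W p`, e.g. from `ClassX3 W p`), an imaginary quadratic
`K` in which every prime of `N_W` splits and a degree-one prime `𝔭 ∋ p` of `K` (the frame's), a
parametrisation datum `Dt_V` of `V` at level `N_V`, the genus character `χ = s` of `Gal(K[p]/K)` with
its Galois character `χ_gal` (inflation along `emb`) and the genus datum `θ ∈ K[p]`, `θ² = p*`,
`σθ = χ(σ)θ`, and the modularity fact `hasEntireLFunction_rat`:
`rankinSelbergDerivValue Dt_V.f χ_gal 1 = LDerivEK W K` — verbatim the hypothesis `hArtin` of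
door-c2 g8's `potMult_additiveIMCLowerBDPOnTreeLeAt_of_valueAt_twisted_of_thm15_of_genusDatum` ((M)
cell, where the cite-only Gross-2004 fact does not apply since `p ∥ N_V`) and the conclusion of
door-c3's `artinLink_of_gross2004` ((G) cell) WITHOUT `Gross2004.rankinLSeries_eq_mul_quadraticTwist`
and WITHOUT `HeegnerConditionRC`. [cite: Gross2004, §2 p. 40] [cite: IrelandRosen1990, Ch. 20 §5 Prop. 20.5.4(b)] -/
theorem artinLink_genus_door {p : ℕ} [Fact p.Prime] (hp2 : p ≠ 2)
    (V : WeierstrassCurve ℚ) [V.IsElliptic] [V.IsGloballyMinimal] [NeZero (V.conductorNorm ℤ)]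
    (D C₂ : WeierstrassCurve.VariableChange ℚ)
    [(C₂ • (D • V).quadraticTwist ((-1 : ℚ) ^ (p / 2) * p)).IsElliptic]
    [(C₂ • (D • V).quadraticTwist ((-1 : ℚ) ^ (p / 2) * p)).IsGloballyMinimal]
    (hadd : Addv (C₂ • (D • V).quadraticTwist ((-1 : ℚ) ^ (p / 2) * p)) p)
    (K : Type) [Field K] [NumberField K] (hK : IsImaginaryQuadratic K)
    (hHe : SatisfiesHeegnerHypothesis
      ((C₂ • (D • V).quadraticTwist ((-1 : ℚ) ^ (p / 2) * p)).conductorNorm ℤ) K)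
    {𝔭 : HeightOneSpectrum (𝓞 K)} (h𝔭 : ((p : ℕ) : 𝓞 K) ∈ 𝔭.asIdeal)
    (he : 𝔭.asIdeal.ramificationIdx (𝓞 ℚ) = 1)
    (ιc : K →+* ℂ) (DtV : ModularParametrizationData V (V.conductorNorm ℤ))
    (χ : ringClassGal ιc p →* ℂˣ) (χgal : absoluteGaloisGroup K →ₜ* ℂˣ)
    (emb : ringClassField K ιc p →+* AlgebraicClosure K) (hinfl : IsInflationAlong ιc p emb χ χgal)
    (s : ringClassGal ιc p → ℤˣ) (hχ : ∀ σ, ((χ σ : ℂˣ) : ℂ) = ((s σ : ℤ) : ℂ))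
    (θ : ringClassField K ιc p)
    (hθ2 : θ ^ 2 = algebraMap ℚ (ringClassField K ιc p) ((-1 : ℚ) ^ (p / 2) * p)) (hθ : θ ≠ 0)
    (hθσ : ∀ σ : ringClassGal ιc p, σ.1 θ = ((s σ : ℤ) : ringClassField K ιc p) * θ)
    (hmod : WeierstrassCurve.hasEntireLFunction_rat) :
    rankinSelbergDerivValue DtV.f χgal 1 =
      LDerivEK (C₂ • (D • V).quadraticTwist ((-1 : ℚ) ^ (p / 2) * p)) K := by
  set W := C₂ • (D • V).quadraticTwist ((-1 : ℚ) ^ (p / 2) * p) with hWdef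
  haveI : Algebra.IsQuadraticExtension ℚ K := ⟨hK.1⟩
  -- `χ_gal` is rational for `p*` (the genus datum)
  have hcast : (((-1 : ℤ) ^ (p / 2) * p : ℤ) : ℚ) = (-1 : ℚ) ^ (p / 2) * p := by push_cast; ring
  have hθ2' : θ ^ 2 = (((-1 : ℤ) ^ (p / 2) * p : ℤ) : ringClassField K ιc p) := by
    rw [hθ2, eq_ratCast, ← hcast, Rat.cast_intCast]
  have hrat : Gross2004.IsRationalCharacterFor χgal ((-1 : ℤ) ^ (p / 2) * p) :=
    isRationalCharacterFor_of_genusDatum ιc p χ χgal emb hinfl s hχ θ hθ2' hθ hθσ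
  -- the presentation `Ctw • (V ⊗ χ_{p*}) = W`
  have hCtw : (C₂ * ⟨D.u, ((-1 : ℚ) ^ (p / 2) * p) * D.r, 0, 0⟩) •
      V.quadraticTwist ((-1 : ℚ) ^ (p / 2) * p) = W := by
    rw [hWdef, mul_smul, ← WeierstrassCurve.quadraticTwist_smul]
  exact artinLink_genus_of_hasEntireLFunction_rat hp2 V W _ hCtw
    (Summit.BirchSwinnertonDyer.Rank1Residual.Additive.hasAdditiveReductionAt_of_addv W p hadd)
    DtV.isNewformOf rfl χgal hrat ⟨𝔭, h𝔭, he⟩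
    (ramificationIdxIn_eq_one_or_isSemistableAt_of_heegner W K hK.1 hHe) hK.1 hmod

end Summit.BirchSwinnertonDyer.BirchSwinnertonDyer.Theorems.SchneiderFree

end
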